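import Mathlib
import HarnessLib
import Summits.NavierStokesRegularity.NavierStokesRegularity.Theses.QuarterTurnRdss
import Literature.Analysis.FluidPDE.SelfSimilar
import Literature.Analysis.FluidPDE.TypeIAncientMild
import Literature.Analysis.FluidPDE.TypeIAncientMildDecay
import Literature.Analysis.FluidPDE.TypeIAncientMildClassical
import Literature.Analysis.FluidPDE.ESSLocalHolderVorticityC12
import Literature.Analysis.FluidPDE.CurlFreeLiouville
import Literature.Analysis.FluidPDE.TaoEnstrophyLocalisation
import Literature.Analysis.FluidPDE.ClassicalSuitableRegion
import Literature.Analysis.FluidPDE.ClassicalSolutionRegion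
import Literature.Analysis.FluidPDE.CarlemanRegularityC12
import Literature.Analysis.FluidPDE.BackwardUniquenessRescale
import Summits.NavierStokesRegularity.NavierStokesRegularity.Theorems.RellichScarApexLocalisationHalfspaceFarFieldCurl
import Summits.NavierStokesRegularity.NavierStokesRegularity.Theorems.DssFarFieldSlavingBlowupTypeIDssProfileSmoothRepresentativeAe

/-!
# `QuarterTurnRdss.NoSilentTypeIProfile`, part I — exterior bounds and the far-field vorticity
  (item stmt-NavierStokesRegularity-1104, route `QuarterTurnRdss`, support; helper file)

HONEST FRAMING: lemmas about HYPOTHETICAL objects (Type-I ancient mild solutions of the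
Navier–Stokes equations, the would-be blow-up profiles); nothing here bears on the regularity
problem itself.

For a field `V` of the KNSS gauge class `IsTypeIAncientMild C₀ V` with the space–time envelope
`HasTypeIDecay C₀ V` (`‖V(t,x)‖ ≤ C₀/(‖x‖ + √(−t))`):
* `exterior_bounds` — all spatial derivatives of order `≤ 3` are bounded on `(−∞,0) × {‖x‖ > ρ}`
  (Chae–Wolf's gauge bounds `IsTypeIAncientMild.gaugeBounds_of_hasTypeIDecay`);
* `farField_curl_eq_zero` — if `∫_{ρ<‖x‖<r} ‖V(t,x)‖ dx → 0` as `t → 0⁻` for every `r > ρ`, then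
  `curl V = 0` on `(−1, 0) × {‖x‖ > ρ}`: Escauriaza–Seregin–Šverák's backward uniqueness across
  half-spaces (Thm. 5.1), through the tree's engine
  `RellichScarApexLocalisation.stub_halfspaceFarFieldCurl` fed with the far region `S = {‖x‖ > ρ}`,
  the classical pressure of the class (`IsTypeIAncientMild.exists_isClassicalNSSolutionOn_Ioo`) and
  the truncated field `w = 𝟙_S V`, whose weak vanishing at the top is the annulus hypothesis;
* two elementary lemmas (`const_eq_zero_of_hasTypeIDecay`, `hasTypeIDecay_comp_sub_right`).
Part II (`QuarterTurnRdssNoSilentTypeIProfile.lean`) does the unique continuation inward and closes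
the item.

References: L. Escauriaza, G. Seregin, V. Šverák, Russ. Math. Surveys 58 (2003) 211–250, §3,
Thm. 5.1 [EscauriazaSereginSverak2003]; D. Chae, J. Wolf, arXiv:1610.09464, (3.6)
[ChaeWolf2017RemovingDSS]; G. Koch, N. Nadirashvili, G. Seregin, V. Šverák, Acta Math. 203 (2009),
§4 [KochNadirashviliSereginSverak2009].
-/

noncomputable section

-- the summit and its single sub-problem share the name (CONVENTIONS §1), as in every Theorems file
set_option linter.dupNamespace false

namespace Summit.NavierStokesRegularity.NavierStokesRegularity.Theorems.NoSilentTypeIProfile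

open MeasureTheory Set Function Metric Filter Topology TopologicalSpace
open scoped ENNReal NNReal InnerProductSpace RealInnerProductSpace
open Literature.Analysis Literature.Analysis.FluidPDE
open Summit.NavierStokesRegularity.NavierStokesRegularity.Theorems.RellichScarApexLocalisation

/-! ### Elementary lemmas -/

/-- A slice of a field with the Type-I space–time bound which is spatially constant vanishes:
`‖b‖ ≤ C₀/(‖x‖ + √(−t))` for all `x` forces `b = 0`. [folklore] -/
theorem const_eq_zero_of_hasTypeIDecay {V : ℝ → EuclideanSpace ℝ (Fin 3) → EuclideanSpace ℝ (Fin 3)}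
    {C₀ : ℝ} (hdec : HasTypeIDecay C₀ V) {t : ℝ} (ht : t < 0) {b : EuclideanSpace ℝ (Fin 3)}
    (hb : ∀ x, V t x = b) : b = 0 := by
  by_contra hne
  have hb0 : 0 < ‖b‖ := norm_pos_iff.2 hne
  have hst : 0 < Real.sqrt (-t) := Real.sqrt_pos.2 (by linarith)
  have hC₀ : 0 ≤ C₀ := by
    by_contra hC
    push Not at hC
    have h := hdec t ht 0
    rw [norm_zero, zero_add] at h
    linarith [norm_nonneg (V t 0), div_neg_of_neg_of_pos hC hst]
  set R : ℝ := C₀ / ‖b‖ + 1 with hR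
  have hR0 : 0 < R := by positivity
  obtain ⟨x, hxn⟩ : ∃ x : EuclideanSpace ℝ (Fin 3), ‖x‖ = R := exists_norm_eq _ hR0.le
  have key := hdec t ht x
  rw [hb x, hxn] at key
  have h1 : C₀ / (R + Real.sqrt (-t)) ≤ C₀ / R :=
    div_le_div_of_nonneg_left hC₀ hR0 (le_add_of_nonneg_right hst.le)
  have h2 : C₀ / R < ‖b‖ := by
    rw [div_lt_iff₀ hR0, hR, mul_add, mul_one, mul_div_cancel₀ _ hb0.ne']
    linarith
  linarith

/-- The Type-I space–time bound is preserved by translations into the past: for `0 ≤ δ` and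
`0 ≤ C₀`, `t ↦ V (t - δ)` again satisfies `HasTypeIDecay C₀` (`√(δ - t) ≥ √(-t)`). [folklore] -/
theorem hasTypeIDecay_comp_sub_right {V : ℝ → EuclideanSpace ℝ (Fin 3) → EuclideanSpace ℝ (Fin 3)}
    {C₀ : ℝ} (hC₀ : 0 ≤ C₀) (hdec : HasTypeIDecay C₀ V) {δ : ℝ} (hδ : 0 ≤ δ) :
    HasTypeIDecay C₀ (fun t => V (t - δ)) := by
  intro t ht x
  refine (hdec (t - δ) (by linarith) x).trans ?_
  have hst : 0 < Real.sqrt (-t) := Real.sqrt_pos.2 (by linarith)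
  have hle : Real.sqrt (-t) ≤ Real.sqrt (-(t - δ)) := Real.sqrt_le_sqrt (by linarith)
  exact div_le_div_of_nonneg_left hC₀ (by positivity) (by linarith [norm_nonneg x])

/-- From `a ^ m * d ≤ C` with `0 < ρ ≤ a`, `0 ≤ d`: `d ≤ C / ρ ^ m`. [folklore] -/
theorem le_div_pow_of_pow_mul_le {ρ a d C : ℝ} {m : ℕ} (hρ : 0 < ρ) (ha : ρ ≤ a) (hd : 0 ≤ d)
    (h : a ^ m * d ≤ C) : d ≤ C / ρ ^ m := by
  have hρm : 0 < ρ ^ m := pow_pos hρ m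
  have ham : ρ ^ m ≤ a ^ m := pow_le_pow_left₀ hρ.le ha m
  rw [le_div_iff₀ hρm]
  calc d * ρ ^ m ≤ d * a ^ m := mul_le_mul_of_nonneg_left ham hd
    _ = a ^ m * d := mul_comm _ _
    _ ≤ C := h


/-! ### Step A: bounds in the exterior region and the far-field vorticity -/

/-- **Exterior bounds up to the top time.** For a KNSS-gauge Type-I field with the space–time
envelope `‖V(t,x)‖ ≤ C₀/(‖x‖ + √(−t))`, all spatial derivatives of order `≤ 3` are bounded on
`(−∞, 0) × {‖x‖ > ρ}` (`ρ > 0`): order `0` by the envelope, orders `1, 2, 3` by the gauge bounds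
`(‖x‖ + √(−t))^{k+1}‖DᵏV(t,x)‖ ≤ C_k` of Chae–Wolf (`IsTypeIAncientMild.gaugeBounds_of_hasTypeIDecay`).
[cite: ChaeWolf2017RemovingDSS, §3 eq. (3.6) (arXiv:1610.09464 p. 8)] -/
theorem exterior_bounds {V : ℝ → EuclideanSpace ℝ (Fin 3) → EuclideanSpace ℝ (Fin 3)} {C₀ ρ : ℝ}
    (hV : IsTypeIAncientMild C₀ V) (hdec : HasTypeIDecay C₀ V) (hρ : 0 < ρ) :
    ∃ K : ℝ, ∀ n ≤ 3, ∀ z ∈ Iio (0 : ℝ) ×ˢ {x : EuclideanSpace ℝ (Fin 3) | ρ < ‖x‖},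
      ‖iteratedFDeriv ℝ n (V z.1) z.2‖ ≤ K := by
  obtain ⟨C₁, C₂, C₃, h1, h2, h3⟩ := IsTypeIAncientMild.gaugeBounds_of_hasTypeIDecay hV hdec
  have hC₀ : 0 ≤ C₀ := hV.nonneg
  refine ⟨max (max (C₀ / ρ) (C₁ / ρ ^ (1 + 1))) (max (C₂ / ρ ^ (2 + 1)) (C₃ / ρ ^ (3 + 1))), ?_⟩
  rintro n hn ⟨t, x⟩ ⟨ht, hx⟩
  have ht' : t < 0 := ht
  have hx' : ρ < ‖x‖ := hx
  have hst : 0 ≤ Real.sqrt (-t) := Real.sqrt_nonneg _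
  have ha : ρ ≤ ‖x‖ + Real.sqrt (-t) := by linarith
  have ha0 : 0 < ‖x‖ + Real.sqrt (-t) := hρ.trans_le ha
  interval_cases n
  · rw [norm_iteratedFDeriv_zero]
    calc ‖V t x‖ ≤ C₀ / (‖x‖ + Real.sqrt (-t)) := hdec t ht' x
      _ ≤ C₀ / ρ := div_le_div_of_nonneg_left hC₀ hρ ha
      _ ≤ _ := le_trans (le_max_left _ _) (le_max_left _ _)
  · calc ‖iteratedFDeriv ℝ 1 (V t) x‖ ≤ C₁ / ρ ^ (1 + 1) :=
          le_div_pow_of_pow_mul_le hρ ha (norm_nonneg _) (h1 t ht' x)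
      _ ≤ _ := le_trans (le_max_right _ _) (le_max_left _ _)
  · calc ‖iteratedFDeriv ℝ 2 (V t) x‖ ≤ C₂ / ρ ^ (2 + 1) :=
          le_div_pow_of_pow_mul_le hρ ha (norm_nonneg _) (h2 t ht' x)
      _ ≤ _ := le_trans (le_max_left _ _) (le_max_right _ _)
  · calc ‖iteratedFDeriv ℝ 3 (V t) x‖ ≤ C₃ / ρ ^ (3 + 1) :=
          le_div_pow_of_pow_mul_le hρ ha (norm_nonneg _) (h3 t ht' x)
      _ ≤ _ := le_trans (le_max_right _ _) (le_max_right _ _)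

/-- **The far-field vorticity vanishes** (Escauriaza–Seregin–Šverák 2003, §3 (3.31)–(3.32) and
Thm. 5.1, backward uniqueness across half-spaces, through the tree's engine
`RellichScarApexLocalisation.stub_halfspaceFarFieldCurl`). If the KNSS-gauge Type-I field `V` with the
space–time envelope has `∫_{ρ<‖x‖<r} ‖V(t,x)‖ dx → 0` as `t → 0⁻` for every `r > ρ` (`ρ > 0`), then
`curl V(t, x) = 0` for `-1 < t < 0`, `‖x‖ > ρ`. The engine is fed with the far region
`S = {‖x‖ > ρ}`, the half-space `ρe + {⟪y, e⟫ > 0} ⊆ S` (`e = x/‖x‖`), the classical pressure of the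
class, the exterior bounds, and the truncated field `w = 𝟙_S V`, whose weak vanishing at the top is
the annulus hypothesis. [cite: EscauriazaSereginSverak2003, §3 (3.31)-(3.32) and Thm. 5.1] -/
theorem farField_curl_eq_zero {V : ℝ → EuclideanSpace ℝ (Fin 3) → EuclideanSpace ℝ (Fin 3)} {C₀ ρ : ℝ}
    (hV : IsTypeIAncientMild C₀ V) (hdec : HasTypeIDecay C₀ V) (hρ : 0 < ρ)
    (htop : ∀ r : ℝ, ρ < r → Tendsto
      (fun t => ∫⁻ x in {x : EuclideanSpace ℝ (Fin 3) | ρ < ‖x‖ ∧ ‖x‖ < r}, ‖V t x‖ₑ) (𝓝[<] 0) (𝓝 0)) :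
    ∀ z ∈ Ioo (-1 : ℝ) 0 ×ˢ {x : EuclideanSpace ℝ (Fin 3) | ρ < ‖x‖}, curl (V z.1) z.2 = 0 := by
  set S : Set (EuclideanSpace ℝ (Fin 3)) := {x | ρ < ‖x‖} with hSdef
  have hS : IsOpen S := isOpen_lt continuous_const continuous_norm
  -- the classical pressure and the distributional equations on `(-1, 0) × S`
  obtain ⟨p, hp⟩ := hV.exists_isClassicalNSSolutionOn_Ioo (t₀ := -1) (by norm_num)
  have hdist : IsDistributionalNSSolutionOn ⟨Ioo (-1 : ℝ) 0 ×ˢ S, isOpen_Ioo.prod hS⟩ 1 0 V p :=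
    hp.onRegion.isDistributionalNSSolutionOn (isOpen_Ioo.prod isOpen_univ)
      (prod_mono Subset.rfl (subset_univ _))
  -- smooth slices, jointly continuous spatial derivatives
  have hU4 : ∀ t ∈ Ioo (-1 : ℝ) 0, ContDiffOn ℝ 4 (V t) S := fun t ht =>
    ((hV.contDiff_slice ht.2).of_le (by norm_cast)).contDiffOn
  have hsm : IsSmoothSpaceTimeOn (Iio 0) V := hV.contDiffOn
  have hΦ : ∀ n ≤ 4, ContinuousOn
      (fun z : ℝ × EuclideanSpace ℝ (Fin 3) => iteratedFDeriv ℝ n (V z.1) z.2) (Ioo (-1 : ℝ) 0 ×ˢ S) :=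
    fun n _ => ((hsm.iteratedFDeriv_slice isOpen_Iio.uniqueDiffOn n).continuousOn).mono
      (prod_mono Ioo_subset_Iio_self (subset_univ _))
  -- the exterior bounds
  obtain ⟨K, hK⟩ := exterior_bounds hV hdec hρ
  have hK' : ∀ n ≤ 3, ∀ z ∈ Ioo (-1 : ℝ) 0 ×ˢ S, ‖iteratedFDeriv ℝ n (V z.1) z.2‖ ≤ K :=
    fun n hn z hz => hK n hn z ⟨hz.1.2, hz.2⟩
  -- the truncated field `w = 𝟙_S V` and its weak vanishing at the top
  set w : ℝ → EuclideanSpace ℝ (Fin 3) → EuclideanSpace ℝ (Fin 3) :=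
    fun s y => if ρ < ‖y‖ then V s y else 0 with hwdef
  have hae : uncurry V =ᵐ[volume.restrict (Ioo (-1 : ℝ) 0 ×ˢ S)] uncurry w := by
    refine (ae_restrict_mem (measurableSet_Ioo.prod hS.measurableSet)).mono fun z hz => ?_
    have hz2 : ρ < ‖z.2‖ := hz.2
    show V z.1 z.2 = w z.1 z.2
    simp only [hwdef, if_pos hz2]
  have htopw : ∀ φ : EuclideanSpace ℝ (Fin 3) → EuclideanSpace ℝ (Fin 3), ContDiff ℝ (⊤ : ℕ∞) φ →
      HasCompactSupport φ → ∀ ε : ℝ, 0 < ε →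
      ∃ s₀ : ℝ, s₀ < 0 ∧ ∀ᵐ s ∂(volume.restrict (Ioo s₀ 0)), |∫ y, ⟪w s y, φ y⟫| ≤ ε := by
    intro φ hφ hφc ε hε
    obtain ⟨M', hM'⟩ := hφ.continuous.bounded_above_of_compact_support hφc
    set M : ℝ := max M' 0 with hMdef
    have hM0 : 0 ≤ M := le_max_right _ _
    have hM : ∀ y, ‖φ y‖ ≤ M := fun y => (hM' y).trans (le_max_left _ _)
    obtain ⟨R, hR⟩ := hφc.isCompact.isBounded.subset_closedBall (0 : EuclideanSpace ℝ (Fin 3))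
    set r : ℝ := max R ρ + 1 with hrdef
    have hρr : ρ < r := by rw [hrdef]; linarith [le_max_right R ρ]
    have hφ0 : ∀ y : EuclideanSpace ℝ (Fin 3), r ≤ ‖y‖ → φ y = 0 := by
      intro y hy
      refine image_eq_zero_of_notMem_tsupport fun h => ?_
      have h' := hR h
      rw [mem_closedBall, dist_zero_right] at h'
      linarith [le_max_left R ρ]
    set A : Set (EuclideanSpace ℝ (Fin 3)) := {y | ρ < ‖y‖ ∧ ‖y‖ < r} with hAdef
    have hAm : MeasurableSet A :=
      ((isOpen_lt continuous_const continuous_norm).inter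
        (isOpen_lt continuous_norm continuous_const)).measurableSet
    have hev : ∀ᶠ s in 𝓝[<] (0 : ℝ), ∫⁻ y in A, ‖V s y‖ₑ < ENNReal.ofReal (ε / (M + 1)) :=
      (tendsto_order.1 (htop r hρr)).2 _ (ENNReal.ofReal_pos.2 (by positivity))
    obtain ⟨s₀, hs₀, hsub⟩ := mem_nhdsLT_iff_exists_Ioo_subset.1 hev
    refine ⟨s₀, hs₀, (ae_restrict_mem measurableSet_Ioo).mono fun s hs => ?_⟩
    have hsmall : ∫⁻ y in A, ‖V s y‖ₑ < ENNReal.ofReal (ε / (M + 1)) := hsub hs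
    -- pointwise bound of the integrand by `M 𝟙_A ‖V‖`
    have hpt : ∀ y, ‖⟪w s y, φ y⟫‖ₑ ≤ A.indicator (fun y => ENNReal.ofReal M * ‖V s y‖ₑ) y := by
      intro y
      by_cases hyA : y ∈ A
      · rw [indicator_of_mem hyA]
        have hwy : w s y = V s y := if_pos hyA.1
        rw [hwy]
        calc ‖⟪V s y, φ y⟫‖ₑ = ENNReal.ofReal ‖⟪V s y, φ y⟫‖ := (ofReal_norm _).symm
          _ ≤ ENNReal.ofReal (M * ‖V s y‖) := ENNReal.ofReal_le_ofReal (by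
              calc ‖⟪V s y, φ y⟫‖ ≤ ‖V s y‖ * ‖φ y‖ := norm_inner_le_norm _ _
                _ ≤ ‖V s y‖ * M := mul_le_mul_of_nonneg_left (hM y) (norm_nonneg _)
                _ = M * ‖V s y‖ := mul_comm _ _)
          _ = ENNReal.ofReal M * ‖V s y‖ₑ := by
              rw [ENNReal.ofReal_mul hM0, ofReal_norm]
      · rw [indicator_of_notMem hyA]
        have h0 : ⟪w s y, φ y⟫ = 0 := by
          by_cases hy1 : ρ < ‖y‖
          · have hy2 : r ≤ ‖y‖ := by
              by_contra h
              push Not at h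
              exact hyA ⟨hy1, h⟩
            rw [hφ0 y hy2, inner_zero_right]
          · have hw0 : w s y = 0 := if_neg hy1
            rw [hw0, inner_zero_left]
        rw [h0, enorm_zero]
    have hlin : ∫⁻ y, ‖⟪w s y, φ y⟫‖ₑ ≤ ENNReal.ofReal M * ∫⁻ y in A, ‖V s y‖ₑ := by
      calc ∫⁻ y, ‖⟪w s y, φ y⟫‖ₑ
          ≤ ∫⁻ y, A.indicator (fun y => ENNReal.ofReal M * ‖V s y‖ₑ) y := lintegral_mono hpt
        _ = ∫⁻ y in A, ENNReal.ofReal M * ‖V s y‖ₑ := lintegral_indicator hAm _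
        _ = ENNReal.ofReal M * ∫⁻ y in A, ‖V s y‖ₑ :=
            lintegral_const_mul' _ _ ENNReal.ofReal_ne_top
    have hfin : ENNReal.ofReal M * ENNReal.ofReal (ε / (M + 1)) ≠ ⊤ :=
      ENNReal.mul_ne_top ENNReal.ofReal_ne_top ENNReal.ofReal_ne_top
    calc |∫ y, ⟪w s y, φ y⟫| = ‖∫ y, ⟪w s y, φ y⟫‖ := (Real.norm_eq_abs _).symm
      _ ≤ (∫⁻ y, ‖⟪w s y, φ y⟫‖ₑ).toReal := by
          have h := norm_integral_le_lintegral_norm (μ := volume)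
            (fun y : EuclideanSpace ℝ (Fin 3) => ⟪w s y, φ y⟫)
          simpa only [ofReal_norm] using h
      _ ≤ (ENNReal.ofReal M * ENNReal.ofReal (ε / (M + 1))).toReal :=
          ENNReal.toReal_mono hfin (hlin.trans (mul_le_mul_of_nonneg_left hsmall.le zero_le))
      _ = M * (ε / (M + 1)) := by
          rw [ENNReal.toReal_mul, ENNReal.toReal_ofReal hM0, ENNReal.toReal_ofReal (by positivity)]
      _ ≤ ε := by
          rw [mul_div_assoc', div_le_iff₀ (by positivity)]
          nlinarith
  -- conclusion at a point `(t, x)` of the exterior: the half-space `ρ e + {⟪y, e⟫ > 0}`, `e = x/‖x‖`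
  rintro ⟨t, x⟩ ⟨ht, hx⟩
  have hx' : ρ < ‖x‖ := hx
  have hx0 : 0 < ‖x‖ := hρ.trans hx'
  set e : EuclideanSpace ℝ (Fin 3) := ‖x‖⁻¹ • x with hedef
  have he : ‖e‖ = 1 := by
    rw [hedef, norm_smul, norm_inv, norm_norm, inv_mul_cancel₀ hx0.ne']
  have hee : ⟪e, e⟫ = 1 := by rw [real_inner_self_eq_norm_sq, he]; norm_num
  set x₀ : EuclideanSpace ℝ (Fin 3) := ρ • e with hx₀def
  have hx₀S : ∀ y : EuclideanSpace ℝ (Fin 3), 0 < ⟪y, e⟫ → x₀ + y ∈ S := by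
    intro y hy
    show ρ < ‖x₀ + y‖
    have h1 : ⟪x₀ + y, e⟫ ≤ ‖x₀ + y‖ := by
      calc ⟪x₀ + y, e⟫ ≤ ‖x₀ + y‖ * ‖e‖ := real_inner_le_norm _ _
        _ = ‖x₀ + y‖ := by rw [he, mul_one]
    have h2 : ⟪x₀ + y, e⟫ = ρ + ⟪y, e⟫ := by
      rw [inner_add_left, hx₀def, real_inner_smul_left, hee, mul_one]
    linarith
  have hmem : ((t, x) : ℝ × EuclideanSpace ℝ (Fin 3)) ∈
      Ioo (-1 : ℝ) 0 ×ˢ {y : EuclideanSpace ℝ (Fin 3) | ⟪x₀, e⟫ < ⟪y, e⟫} := by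
    refine ⟨ht, ?_⟩
    show ⟪x₀, e⟫ < ⟪x, e⟫
    have h1 : ⟪x₀, e⟫ = ρ := by rw [hx₀def, real_inner_smul_left, hee, mul_one]
    have h2 : ⟪x, e⟫ = ‖x‖ := by
      rw [hedef, real_inner_smul_right, real_inner_self_eq_norm_sq]
      field_simp
    rw [h1, h2]
    exact hx'
  exact stub_halfspaceFarFieldCurl S hS x₀ e he hx₀S w V p K htopw hae hdist hU4 hΦ hK' (t, x) hmem

end Summit.NavierStokesRegularity.NavierStokesRegularity.Theorems.NoSilentTypeIProfile

end
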